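import Summits.CriticalPhenomena.SAWScalingLimit.Theorems.CriticalBubbleBound.Negative.CriticalBubbleBoundLatticeKernel
import Literature.Barriers.CriticalPhenomena.SupercriticalSAWSpaceFillingFilamentsCusp
import Literature.Probability.LatticeModels.WeakBeurlingEstimate
import Literature.Probability.LatticeModels.IsoradialGraphsProofs

/-!
# Walk toolkit for the corridor gadget of `BoundaryHarnack` (stmt-CriticalPhenomena-7120)

Generic, graph-theoretic facts used by the converse direction
`BoundaryHarnack ⇒ uniform half-plane arch bound`:

* `getVert_eq_of_forced` — **forced traversal of a private corridor**: if a path starts along a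
  chain of vertices `c 0, c 1, …, c m` whose internal vertices `c i` (`1 ≤ i < m`) have all their
  neighbours among `c (i-1), c (i+1)` and are not the endpoint of the path, then the path visits
  `c 0, …, c m` in order;
* `drop_avoids_of_forced` — the remainder of such a path avoids `c 0, …, c (m-1)`;
* `weight_univ_ne_top_of_isBounded` — partition functions of bounded discrete domains are finite
  (via the barrier catalogue's `finite_domainSAW_of_isBounded`);
(lattice steps in coordinates are taken from the tree: `Percolation.adj_of_stepKind`,
`WeakBeurling.coord_step_of_adj`, `LatticeModels.vec2_eq_iff`).

Everything proved. [folklore]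
-/

noncomputable section

namespace Summit.CriticalPhenomena.SAWScalingLimit.Theorems.BoundaryHarnack.Negative

open Literature.Probability.LatticeModels Literature.Probability.RandomPlanarGeometry
open Literature.Probability.RandomPlanarGeometry.SAW Set
open scoped ENNReal

/-! ### Forced traversal of a private corridor -/

section Forcing

variable {X : Type*} {G : SimpleGraph X}

/-- **Forced traversal.** Let `ω` be a path from `c 0` whose second vertex is `c 1`, and suppose
that for `1 ≤ i < m` the vertex `c i` is not the endpoint of `ω` and all its neighbours are among
`c (i-1)`, `c (i+1)`. Then `ω` passes through `c 0, c 1, …, c m` in this order: `ω.getVert i = c i`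
for `i ≤ m` (and `m ≤ ω.length`). [folklore] -/
theorem getVert_eq_of_forced {s v : X} (ω : G.Walk s v) (hω : ω.IsPath) (c : ℕ → X) (m : ℕ)
    (h0 : c 0 = s) (h1 : ω.getVert 1 = c 1) (hlen : 1 ≤ ω.length)
    (hne : ∀ i, 1 ≤ i → i < m → c i ≠ v)
    (hnb : ∀ i, 1 ≤ i → i < m → ∀ z, G.Adj (c i) z → z = c (i - 1) ∨ z = c (i + 1)) :
    ∀ i, i ≤ m → i ≤ ω.length ∧ ω.getVert i = c i := by
  -- strengthen to all `j ≤ i`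
  suffices key : ∀ i, i ≤ m → ∀ j, j ≤ i → j ≤ ω.length ∧ ω.getVert j = c j from
    fun i hi => key i hi i le_rfl
  intro i
  induction i with
  | zero =>
    intro _ j hj
    obtain rfl : j = 0 := Nat.le_zero.1 hj
    exact ⟨Nat.zero_le _, by rw [SimpleGraph.Walk.getVert_zero, h0]⟩
  | succ i ih =>
    intro him j hj
    rcases Nat.lt_or_ge j (i + 1) with hji | hji
    · exact ih (Nat.le_of_succ_le him) j (Nat.lt_succ_iff.1 hji)
    have hj' : j = i + 1 := le_antisymm hj hji
    subst hj'
    rcases Nat.eq_zero_or_pos i with rfl | hi0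
    · exact ⟨hlen, by simpa using h1⟩
    -- `1 ≤ i < m`: the step from `c i` goes to a neighbour other than `c (i-1)`
    have him' : i < m := Nat.lt_of_succ_le him
    obtain ⟨hil, hgi⟩ := ih (Nat.le_of_succ_le him) i le_rfl
    obtain ⟨_, hgi'⟩ := ih (Nat.le_of_succ_le him) (i - 1) (Nat.sub_le i 1)
    have hilt : i < ω.length := by
      rcases Nat.lt_or_ge i ω.length with h | h
      · exact h
      · exfalso
        have : ω.getVert i = v := ω.getVert_of_length_le h
        exact hne i hi0 him' (hgi ▸ this)
    have hadj : G.Adj (c i) (ω.getVert (i + 1)) := hgi ▸ ω.adj_getVert_succ hilt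
    rcases hnb i hi0 him' _ hadj with h | h
    · -- back-tracking contradicts injectivity of `getVert` on a path
      exfalso
      have hinj := hω.getVert_injOn (by simp only [Set.mem_setOf_eq]; omega : i + 1 ∈ {k | k ≤ ω.length})
        (by simp only [Set.mem_setOf_eq]; omega : i - 1 ∈ {k | k ≤ ω.length}) (h.trans hgi'.symm)
      omega
    · exact ⟨hilt, h⟩

/-- Under forced traversal, the remainder `ω.drop m` of the path avoids the corridor vertices
`c 0, …, c (m-1)`. [folklore] -/
theorem drop_avoids_of_forced {s v : X} (ω : G.Walk s v) (hω : ω.IsPath) (c : ℕ → X) (m : ℕ)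
    (hm : ∀ i, i ≤ m → i ≤ ω.length ∧ ω.getVert i = c i) :
    ∀ w ∈ (ω.drop m).support, ∀ i, i < m → w ≠ c i := by
  intro w hw i hi hwi
  rw [SimpleGraph.Walk.mem_support_iff_exists_getVert] at hw
  obtain ⟨n, hn, hnl⟩ := hw
  rw [SimpleGraph.Walk.drop_getVert] at hn
  rw [SimpleGraph.Walk.drop_length] at hnl
  have hml : m ≤ ω.length := (hm m le_rfl).1
  have h1 : ω.getVert (m + n) = ω.getVert i := by rw [hn, hwi, (hm i hi.le).2]
  have hinj := hω.getVert_injOn (by simp only [Set.mem_setOf_eq]; omega : m + n ∈ {k | k ≤ ω.length})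
    (by simp only [Set.mem_setOf_eq]; omega : i ∈ {k | k ≤ ω.length}) h1
  omega

/-- The remainder of a path is a path. [folklore] -/
theorem isPath_drop {s v : X} (ω : G.Walk s v) (hω : ω.IsPath) (m : ℕ) : (ω.drop m).IsPath := by
  refine SimpleGraph.Walk.IsPath.mk' ?_
  rw [SimpleGraph.Walk.drop_support_eq_support_drop_min]
  exact hω.support_nodup.sublist (List.drop_sublist _ _)

/-- A path is determined by its first `m` vertices and its remainder after `m` steps. [folklore] -/
theorem eq_of_drop_eq {s v : X} (ω₁ ω₂ : G.Walk s v) (m : ℕ)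
    (hpre : ∀ i, i ≤ m → ω₁.getVert i = ω₂.getVert i) (hm₁ : m ≤ ω₁.length) (hm₂ : m ≤ ω₂.length)
    (hlen : (ω₁.drop m).length = (ω₂.drop m).length)
    (hdrop : ∀ k, (ω₁.drop m).getVert k = (ω₂.drop m).getVert k) : ω₁ = ω₂ := by
  have hl : ω₁.length = ω₂.length := by
    rw [SimpleGraph.Walk.drop_length, SimpleGraph.Walk.drop_length] at hlen
    omega
  refine SimpleGraph.Walk.ext_getVert_le_length hl fun k _ => ?_
  rcases Nat.lt_or_ge k m with hk | hk
  · exact hpre k hk.le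
  · obtain ⟨j, rfl⟩ := Nat.exists_eq_add_of_le hk
    have := hdrop j
    rwa [SimpleGraph.Walk.drop_getVert, SimpleGraph.Walk.drop_getVert] at this

end Forcing

/-! ### Finiteness of partition functions of bounded domains -/

/-- Vertices of a walk of `Ω_δ` from a vertex of `Ω_δ` lie in `Ω_δ`. [folklore] -/
theorem support_subset_meshDomain {Ω : Set ℂ} {δ : ℝ} {u v : Site 2}
    (p : (discreteDomainGraph Ω δ).Walk u v) (hu : u ∈ meshDomain Ω δ) :
    ∀ w ∈ p.support, w ∈ meshDomain Ω δ := by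
  induction p with
  | nil => intro w hw; rw [SimpleGraph.Walk.support_nil, List.mem_singleton] at hw; exact hw ▸ hu
  | cons h p ih =>
    intro w hw
    rw [SimpleGraph.Walk.support_cons, List.mem_cons] at hw
    rcases hw with rfl | hw
    · exact hu
    · exact ih (discreteDomainGraph_adj_iff.1 h).2.2 w hw

/-- **Partition functions of bounded discrete domains are finite**: for bounded `Ω`, `δ > 0` and
a vertex `u` of `Ω_δ`, `Z(u,v) = SAW.weight Ω δ u v univ < ∞`. [folklore] -/
theorem weight_univ_ne_top_of_isBounded {Ω : Set ℂ} {δ : ℝ} (hΩ : Bornology.IsBounded Ω)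
    (hδ : 0 < δ) {u v : Site 2} (hu : u ∈ meshDomain Ω δ) : SAW.weight Ω δ u v univ ≠ ⊤ := by
  haveI := Literature.Barriers.CriticalPhenomena.SupercriticalSAW.finite_domainSAW_of_isBounded hΩ hδ hu (v := v)
  haveI : Fintype (DomainSAW Ω δ u v) := Fintype.ofFinite _
  rw [CriticalBubbleBound.Negative.weight_univ, tsum_fintype]
  exact ENNReal.sum_ne_top.2 fun _ _ => ENNReal.ofReal_ne_top

end Summit.CriticalPhenomena.SAWScalingLimit.Theorems.BoundaryHarnack.Negative
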